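import Summits.AtomisticToContinuum.BoseEinsteinCondensation.Theorems.BECCellInformationOneBodyEntropyBoundWithinCellFisherLSIHelpers

/-!
# Crux `OneBodyEntropyBound` (stmt-AtomisticToContinuum-13440), line `registered`:
# stub `stub_withinCellFisherLSI` — within-cell entropy via Fisher convexity and the cube LSI

Support file (`--supports stmt-AtomisticToContinuum-13440`) proving the registered stub
`stub_withinCellFisherLSI` of the birth skeleton (`Lines/birth.lean`) of the crux
`OneBodyEntropyBound` of the route
`Summit.AtomisticToContinuum.BoseEinsteinCondensation.Theses.BECCellInformation`: for every trial
state `Ψ ∈ TrialState (n+1) L`, every `M ≥ 1` and the `M³` half-open cells `Q_k` of side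
`s = L/M`, the mass-weighted within-cell relative entropies of the one-body marginal
`P(x) = ∫ |Ψ(x :: Y)|² dY` (cell masses `A_k = ∫_{Q_k} P`) satisfy

  `Σ_k ∫_{Q_k} (A_k/s³) klFun(s³ P / A_k) ≤ 3 + s² · T(Ψ)/(n+1)`.

Proof summary:
1. (`cell_lsi_eps`) on a cell with `A_k > 0`, the PROVED defective cube LSI
   `TwoScaleReduction.lsi_cell` for the `C¹` function `G_ε = √(P + ε)`, `ε > 0`
   (`WithinCell.contDiff_sqrt_marginal` of the helper file `…WithinCellFisherLSIHelpers.lean`,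
   registered helper stub `stub_withinCellFisherBound`: `P` is `C¹` by differentiation under the
   integral sign),
   with the Fisher bound `Σ_i (∂_i G_ε)² ≤ ∫ |∇₀Ψ|²(x :: Y) dY` (`WithinCell.fisher_bound`,
   Cauchy–Schwarz in `L²(dY)`): `∫_Q (P+ε) log(s³(P+ε)/(A+εs³)) ≤ 3(A+εs³) + s² ∫_Q∫|∇₀Ψ|²`;
2. (`setIntegral_klFun_eq`) the left side is `∫_Q ((A+εs³)/s³) klFun(s³(P+ε)/(A+εs³))`
   (`vol Q = s³`, the affine part of `klFun` integrates to zero);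
3. (`cell_bound_real`, `cell_bound`) `ε ↓ 0` by dominated convergence on the compact cell (`P` is
   continuous and bounded, `klFun` continuous); empty cells and cells of infinite tagged kinetic
   energy are trivial;
4. (`core`, `stub_withinCellFisherLSI`) sum over the disjoint cells: `Σ_k A_k ≤ ∫ P = 1`,
   `Σ_k ∫_{Q_k}∫|∇₀Ψ|² ≤ ∫ |∇₀Ψ|² = T/(n+1)` (Bose symmetry, `lintegral_kineticDensity_eq_mul`).
-/

noncomputable section

namespace Summit.AtomisticToContinuum.BoseEinsteinCondensation.Cruxes.OneBodyEntropyBound.Birth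

namespace WithinCell

open MeasureTheory Set Filter Topology InformationTheory
open scoped ENNReal NNReal
open Literature.MathematicalPhysics.QuantumManyBody.BoseGas
open Summit.AtomisticToContinuum.BoseEinsteinCondensation.Theorems

variable {n : ℕ} {L : ℝ} {M : ℕ}

/-! ### Global properties of the marginal -/

/-- The marginal vanishes off the open box (Dirichlet condition in the tagged particle).
[folklore] -/
theorem marginal_eq_zero_of_not_mem (Ψ : TrialState (n + 1) L) {x : Space} (hx : x ∉ box L) :
    ∫ Y : Config n, ‖Ψ.ψ (Matrix.vecCons x Y)‖ ^ 2 = 0 := by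
  simp [CoarseChainRule.normSq_vecCons_eq_zero Ψ hx]

/-- The marginal is bounded. [folklore] -/
theorem exists_bound_marginal (Ψ : TrialState (n + 1) L) :
    ∃ B, ∀ x, ∫ Y : Config n, ‖Ψ.ψ (Matrix.vecCons x Y)‖ ^ 2 ≤ B := by
  have hK : IsCompact {y : Space | ∀ j, y j ∈ Icc (0 : ℝ) L} :=
    TwoScaleReduction.isCompact_IccCell (fun _ => 0) (fun _ => L)
  have hsupp : HasCompactSupport fun x => ∫ Y : Config n, ‖Ψ.ψ (Matrix.vecCons x Y)‖ ^ 2 :=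
    HasCompactSupport.intro hK fun x hx =>
      marginal_eq_zero_of_not_mem Ψ fun hb => hx fun j => Ioo_subset_Icc_self (hb j)
  obtain ⟨C, hC⟩ := (continuous_marginal Ψ).bounded_above_of_compact_support hsupp
  exact ⟨C, fun x => (Real.le_norm_self _).trans (hC x)⟩

/-- The marginal has total mass one. [folklore] -/
theorem integral_marginal (Ψ : TrialState (n + 1) L) :
    ∫ x, ∫ Y : Config n, ‖Ψ.ψ (Matrix.vecCons x Y)‖ ^ 2 = 1 := by
  rw [← integral_prod _ (CoarseChainRule.integrable_normSq_vecCons Ψ)]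
  exact CoarseChainRule.integral_normSq_vecCons_prod Ψ

/-- `klFun u ≤ u² + 2` for `u ≥ 0`. [folklore] -/
theorem klFun_le_sq_add_two {u : ℝ} (hu : 0 ≤ u) : klFun u ≤ u ^ 2 + 2 := by
  rw [klFun_apply]
  have h := TwoScaleReduction.abs_mul_log_le hu
  have h2 := le_abs_self (u * Real.log u)
  linarith

/-! ### The cells -/

/-- A sub-cell of side `s ≥ 0` has volume `s³`. [folklore] -/
theorem volume_subCell {s : ℝ} (hs : 0 ≤ s) (k : Fin 3 → Fin M) :
    volume (subCell s k) = ENNReal.ofReal (s ^ 3) := by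
  rw [← TwoScaleReduction.routeCell_eq_subCell]
  exact CoarseChainRule.volume_cell hs k

/-- … as a real number. [folklore] -/
theorem volume_real_subCell {s : ℝ} (hs : 0 ≤ s) (k : Fin 3 → Fin M) :
    volume.real (subCell s k) = s ^ 3 := by
  rw [measureReal_def, volume_subCell hs k, ENNReal.toReal_ofReal (pow_nonneg hs 3)]

/-- A sub-cell lies in the corresponding compact closed cell. [folklore] -/
theorem subCell_subset_IccCell (s : ℝ) (k : Fin 3 → Fin M) :
    subCell s k ⊆ {y : Space | ∀ j, y j ∈ Icc (s * ((k j : ℕ) : ℝ)) (s * ((k j : ℕ) : ℝ) + s)} :=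
  fun _ hy j => ⟨((mem_subCell.1 hy) j).1, ((mem_subCell.1 hy) j).2.le⟩

/-- Continuous functions are integrable on sub-cells. [folklore] -/
theorem integrableOn_subCell {s : ℝ} (k : Fin 3 → Fin M) {F : Space → ℝ} (hF : Continuous F) :
    IntegrableOn F (subCell s k) :=
  (hF.continuousOn.integrableOn_compact (TwoScaleReduction.isCompact_IccCell _ _)).mono_set
    (subCell_subset_IccCell s k)

/-! ### The regularised cell inequality and its limit -/

/-- **Step 1 (regularised cell LSI for the marginal).** For `ε > 0`, the cube LSI `lsi_cell`
for `G_ε = √(P + ε)` and the Fisher bound `Σ_i (∂_i G_ε)² ≤ ∫ |∇₀Ψ|² dY` give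
`∫_Q (P+ε) log(s³(P+ε)/(A+εs³)) ≤ 3(A+εs³) + s² R`, `R = ∫_Q ∫ |∇₀Ψ|²(x::Y) dY dx < ∞`.
[folklore] -/
theorem cell_lsi_eps {s : ℝ} (hs : 0 < s) (Ψ : TrialState (n + 1) L) (P : Space → ℝ)
    (hP : P = fun x => ∫ Y : Config n, ‖Ψ.ψ (Matrix.vecCons x Y)‖ ^ 2) (k : Fin 3 → Fin M)
    (hR : ∫⁻ x in subCell s k, ∫⁻ Y, partialGradSq 0 Ψ.ψ (Matrix.vecCons x Y) ≠ ⊤)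
    {ε : ℝ} (hε : 0 < ε) :
    ∫ x in subCell s k, (P x + ε) *
        Real.log (s ^ 3 * (P x + ε) / ((∫ z in subCell s k, P z) + ε * s ^ 3)) ≤
      3 * ((∫ z in subCell s k, P z) + ε * s ^ 3) +
        s ^ 2 * (∫⁻ x in subCell s k, ∫⁻ Y, partialGradSq 0 Ψ.ψ (Matrix.vecCons x Y)).toReal := by
  set Q := subCell s k with hQ
  set R := ∫⁻ x in Q, ∫⁻ Y, partialGradSq 0 Ψ.ψ (Matrix.vecCons x Y) with hRdef
  have hPc : Continuous P := by rw [hP]; exact continuous_marginal Ψ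
  have hP0 : ∀ x, 0 ≤ P x := fun x => by rw [hP]; exact marginal_nonneg Ψ x
  -- the regularised root and the cube LSI
  have hG : ContDiff ℝ 1 fun x => Real.sqrt (P x + ε) := by
    rw [hP]; exact contDiff_sqrt_marginal Ψ hε
  have hG2 : ∀ x, Real.sqrt (P x + ε) ^ 2 = P x + ε := fun x =>
    Real.sq_sqrt (add_pos_of_nonneg_of_pos (hP0 x) hε).le
  have h := TwoScaleReduction.lsi_cell hs (fun x => Real.sqrt (P x + ε)) hG
    (fun j => ((k j : ℕ) : ℝ) * s)
  simp only [TwoScaleReduction.IcoCell_eq_subCell, hG2] at h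
  -- the mass of the regularised density on the cell
  have hAε : ∫ x in Q, (P x + ε) = (∫ z in Q, P z) + ε * s ^ 3 := by
    rw [integral_add (integrableOn_subCell k hPc) (integrableOn_subCell k continuous_const),
      setIntegral_const, volume_real_subCell hs.le k, smul_eq_mul, mul_comm]
  rw [hAε] at h
  -- the gradient term
  have hD : ∫ x in Q, ∑ i, (fderiv ℝ (fun y => Real.sqrt (P y + ε)) x
      (EuclideanSpace.single i 1)) ^ 2 ≤ R.toReal := by
    rw [← ENNReal.ofReal_le_iff_le_toReal hR]
    calc ENNReal.ofReal (∫ x in Q, ∑ i, (fderiv ℝ (fun y => Real.sqrt (P y + ε)) x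
            (EuclideanSpace.single i 1)) ^ 2)
        ≤ ∫⁻ x in Q, ENNReal.ofReal (∑ i, (fderiv ℝ (fun y => Real.sqrt (P y + ε)) x
            (EuclideanSpace.single i 1)) ^ 2) :=
          TwoScaleReduction.ofReal_integral_le_lintegral fun x =>
            Finset.sum_nonneg fun i _ => sq_nonneg _
      _ ≤ R := lintegral_mono fun x => by rw [hP]; exact fisher_bound Ψ hε x
  have hs2 : 0 ≤ s ^ 2 := sq_nonneg _
  nlinarith [h, hD, mul_le_mul_of_nonneg_left hD hs2]

/-- **Step 2 (`klFun` form of the cell entropy).** For a continuous `φ` with `∫_Q φ = c ≠ 0`: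
`∫_Q (c/s³) klFun(s³φ/c) = ∫_Q φ log(s³φ/c)` (the affine part of `klFun` integrates to zero,
`vol Q = s³`). [folklore] -/
theorem setIntegral_klFun_eq {s : ℝ} (hs : 0 < s) (k : Fin 3 → Fin M) {φ : Space → ℝ}
    (hφ : Continuous φ) {c : ℝ} (hc : c ≠ 0) (hmass : ∫ x in subCell s k, φ x = c) :
    ∫ x in subCell s k, c / s ^ 3 * klFun (s ^ 3 * φ x / c) =
      ∫ x in subCell s k, φ x * Real.log (s ^ 3 * φ x / c) := by
  have hs3 : s ^ 3 ≠ 0 := by positivity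
  have hpt : ∀ x, c / s ^ 3 * klFun (s ^ 3 * φ x / c) =
      φ x * Real.log (s ^ 3 * φ x / c) + (c / s ^ 3 - φ x) := by
    intro x; rw [klFun_apply]; field_simp; ring
  simp_rw [hpt]
  have i1 : IntegrableOn (fun x => φ x * Real.log (s ^ 3 * φ x / c)) (subCell s k) :=
    integrableOn_subCell k (TwoScaleReduction.continuous_mul_log_mul_div hφ _ _)
  have i2 : IntegrableOn (fun x => c / s ^ 3 - φ x) (subCell s k) :=
    (integrableOn_subCell k continuous_const).sub (integrableOn_subCell k hφ)
  rw [integral_add i1 i2, integral_sub (integrableOn_subCell k continuous_const)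
    (integrableOn_subCell k hφ), setIntegral_const, volume_real_subCell hs.le k, smul_eq_mul,
    hmass, mul_div_cancel₀ c hs3, sub_self, add_zero]

/-- **Step 3 (the limit `ε → 0⁺`, real form).** On a cell with `A = ∫_Q P > 0` and finite
tagged kinetic energy `R = ∫_Q ∫ |∇₀Ψ|² < ∞`: `∫_Q (A/s³) klFun(s³P/A) ≤ 3A + s² R`
(dominated convergence on the cell: `P` is continuous and bounded, `klFun` is continuous).
[folklore] -/
theorem cell_bound_real {s : ℝ} (hs : 0 < s) (Ψ : TrialState (n + 1) L) (P : Space → ℝ)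
    (hP : P = fun x => ∫ Y : Config n, ‖Ψ.ψ (Matrix.vecCons x Y)‖ ^ 2) (k : Fin 3 → Fin M)
    (hA : 0 < ∫ z in subCell s k, P z)
    (hR : ∫⁻ x in subCell s k, ∫⁻ Y, partialGradSq 0 Ψ.ψ (Matrix.vecCons x Y) ≠ ⊤) :
    ∫ x in subCell s k, (∫ z in subCell s k, P z) / s ^ 3 *
        klFun (s ^ 3 * P x / ∫ z in subCell s k, P z) ≤
      3 * (∫ z in subCell s k, P z) +
        s ^ 2 * (∫⁻ x in subCell s k, ∫⁻ Y, partialGradSq 0 Ψ.ψ (Matrix.vecCons x Y)).toReal := by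
  set Q := subCell s k with hQ
  set A := ∫ z in Q, P z with hAdef
  set R := ∫⁻ x in Q, ∫⁻ Y, partialGradSq 0 Ψ.ψ (Matrix.vecCons x Y) with hRdef
  have hPc : Continuous P := by rw [hP]; exact continuous_marginal Ψ
  have hP0 : ∀ x, 0 ≤ P x := fun x => by rw [hP]; exact marginal_nonneg Ψ x
  obtain ⟨B, hB⟩ : ∃ B, ∀ x, P x ≤ B := by rw [hP]; exact exists_bound_marginal Ψ
  have hs3 : 0 < s ^ 3 := by positivity
  -- the regularised integrands
  set F : ℝ → Space → ℝ := fun ε x => (A + ε * s ^ 3) / s ^ 3 *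
    klFun (s ^ 3 * (P x + ε) / (A + ε * s ^ 3)) with hF
  -- Steps 1 + 2: the regularised inequality in `klFun` form
  have hFle : ∀ ε, 0 < ε → ∫ x in Q, F ε x ≤ 3 * (A + ε * s ^ 3) + s ^ 2 * R.toReal := by
    intro ε hε
    have hc : A + ε * s ^ 3 ≠ 0 := by positivity
    have hmass : ∫ x in Q, (P x + ε) = A + ε * s ^ 3 := by
      rw [integral_add (integrableOn_subCell k hPc) (integrableOn_subCell k continuous_const),
        setIntegral_const, volume_real_subCell hs.le k, smul_eq_mul, mul_comm]
    have hφ : Continuous fun x => P x + ε := hPc.add continuous_const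
    have h2 := setIntegral_klFun_eq hs k hφ hc hmass
    simp only [hF]
    rw [h2]
    exact cell_lsi_eps hs Ψ P hP k hR hε
  -- Step 3: dominated convergence on the cell
  have hlim : Tendsto (fun ε => ∫ x in Q, F ε x) (𝓝[>] 0) (𝓝 (∫ x in Q, F 0 x)) := by
    refine tendsto_integral_filter_of_dominated_convergence
      (fun _ => (A + s ^ 3) / s ^ 3 * ((s ^ 3 * (B + 1) / A) ^ 2 + 2)) ?_ ?_ ?_ ?_
    · refine Eventually.of_forall fun ε => Continuous.aestronglyMeasurable ?_
      exact continuous_const.mul (continuous_klFun.comp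
        ((continuous_const.mul (hPc.add continuous_const)).div_const _))
    · filter_upwards [Ioo_mem_nhdsGT (zero_lt_one' ℝ)] with ε hε
      refine Eventually.of_forall fun x => ?_
      have hε0 : 0 < ε := hε.1
      have hAε : A ≤ A + ε * s ^ 3 := le_add_of_nonneg_right (by positivity)
      have hu0 : 0 ≤ s ^ 3 * (P x + ε) / (A + ε * s ^ 3) := by
        have := hP0 x; positivity
      have huU : s ^ 3 * (P x + ε) / (A + ε * s ^ 3) ≤ s ^ 3 * (B + 1) / A :=
        div_le_div₀ (by nlinarith [hB x, hP0 x]) (by nlinarith [hB x, hε.2]) hA hAε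
      have hkl : klFun (s ^ 3 * (P x + ε) / (A + ε * s ^ 3)) ≤ (s ^ 3 * (B + 1) / A) ^ 2 + 2 :=
        (klFun_le_sq_add_two hu0).trans (by nlinarith [pow_le_pow_left₀ hu0 huU 2])
      have hco : (A + ε * s ^ 3) / s ^ 3 ≤ (A + s ^ 3) / s ^ 3 :=
        div_le_div_of_nonneg_right (by nlinarith [hε.2]) hs3.le
      rw [Real.norm_eq_abs, abs_of_nonneg (mul_nonneg (by positivity) (klFun_nonneg hu0))]
      exact mul_le_mul hco hkl (klFun_nonneg hu0) (by positivity)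
    · refine integrableOn_const ?_
      rw [hQ, volume_subCell hs.le k]; exact ENNReal.ofReal_ne_top
    · refine Eventually.of_forall fun x => ?_
      have hg : ContinuousAt (fun ε : ℝ => s ^ 3 * (P x + ε) / (A + ε * s ^ 3)) 0 :=
        (continuousAt_const.mul (continuousAt_const.add continuousAt_id)).div
          (continuousAt_const.add (continuousAt_id.mul continuousAt_const)) (by simpa using hA.ne')
      have hcont : ContinuousAt (fun ε => F ε x) 0 :=
        ((continuousAt_const.add (continuousAt_id.mul continuousAt_const)).div_const _).mul
          (continuous_klFun.continuousAt.comp hg)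
      exact hcont.tendsto.mono_left nhdsWithin_le_nhds
  -- the value at `ε = 0` and the limit of the right-hand side
  have hF0 : ∫ x in Q, F 0 x = ∫ x in Q, A / s ^ 3 * klFun (s ^ 3 * P x / A) := by
    simp only [hF, zero_mul, add_zero]
  have hrhs : Tendsto (fun ε : ℝ => 3 * (A + ε * s ^ 3) + s ^ 2 * R.toReal) (𝓝[>] 0)
      (𝓝 (3 * A + s ^ 2 * R.toReal)) := by
    have hc : Continuous fun ε : ℝ => 3 * (A + ε * s ^ 3) + s ^ 2 * R.toReal := by fun_prop
    have h := hc.tendsto 0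
    simp only [zero_mul, add_zero] at h
    exact h.mono_left nhdsWithin_le_nhds
  have hev : ∀ᶠ ε in 𝓝[>] (0 : ℝ), ∫ x in Q, F ε x ≤ 3 * (A + ε * s ^ 3) + s ^ 2 * R.toReal :=
    eventually_mem_nhdsWithin.mono fun ε hε => hFle ε hε
  rw [← hF0]
  exact le_of_tendsto_of_tendsto hlim hrhs hev

/-- **The cell inequality** (`[0, ∞]`-valued): `A·KL(p_Q ‖ u_Q) ≤ 3A + s² ∫_Q ∫ |∇₀Ψ|²`
for the one-body marginal on every sub-cell `Q` of side `s` (empty cells and cells of infinite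
tagged kinetic energy are trivial). [folklore] -/
theorem cell_bound {s : ℝ} (hs : 0 < s) (Ψ : TrialState (n + 1) L) (P : Space → ℝ)
    (hP : P = fun x => ∫ Y : Config n, ‖Ψ.ψ (Matrix.vecCons x Y)‖ ^ 2) (k : Fin 3 → Fin M) :
    ENNReal.ofReal (∫ x in subCell s k, (∫ z in subCell s k, P z) / s ^ 3 *
        klFun (s ^ 3 * P x / ∫ z in subCell s k, P z)) ≤
      ENNReal.ofReal (3 * ∫ z in subCell s k, P z) +
        ENNReal.ofReal (s ^ 2) *
          ∫⁻ x in subCell s k, ∫⁻ Y, partialGradSq 0 Ψ.ψ (Matrix.vecCons x Y) := by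
  set A := ∫ z in subCell s k, P z with hAdef
  set R := ∫⁻ x in subCell s k, ∫⁻ Y, partialGradSq 0 Ψ.ψ (Matrix.vecCons x Y) with hRdef
  have hA0 : 0 ≤ A :=
    setIntegral_nonneg (measurableSet_subCell s k) fun x _ => by rw [hP]; exact marginal_nonneg Ψ x
  rcases hA0.eq_or_lt with hA | hA
  · rw [← hA]; simp
  by_cases hR : R = ⊤
  · rw [hR, ENNReal.mul_top (ENNReal.ofReal_pos.2 (by positivity)).ne', add_top]; exact le_top
  calc ENNReal.ofReal (∫ x in subCell s k, A / s ^ 3 * klFun (s ^ 3 * P x / A))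
      ≤ ENNReal.ofReal (3 * A + s ^ 2 * R.toReal) :=
        ENNReal.ofReal_le_ofReal (cell_bound_real hs Ψ P hP k hA hR)
    _ = ENNReal.ofReal (3 * A) + ENNReal.ofReal (s ^ 2) * R := by
        rw [ENNReal.ofReal_add (by positivity) (by positivity), ENNReal.ofReal_mul (sq_nonneg _),
          ENNReal.ofReal_toReal hR]

/-! ### Summing over the cells -/

/-- `x ↦ ∫ |∇₀Ψ|²(x :: Y) dY` is measurable. [folklore] -/
theorem measurable_lintegral_partialGradSq_vecCons (Ψ : TrialState (n + 1) L) :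
    Measurable fun x : Space => ∫⁻ Y : Config n, partialGradSq 0 Ψ.ψ (Matrix.vecCons x Y) :=
  ((measurable_partialGradSq 0 Ψ.ψ).comp measurable_vecCons).lintegral_prod_right'

/-- The cell masses of the marginal sum to at most one. [folklore] -/
theorem sum_setIntegral_marginal_le {s : ℝ} (hs : 0 < s) (Ψ : TrialState (n + 1) L) :
    ∑ k : Fin 3 → Fin M, ∫ z in subCell s k, ∫ Y : Config n, ‖Ψ.ψ (Matrix.vecCons z Y)‖ ^ 2 ≤
      1 := by
  have hi : Integrable fun x => ∫ Y : Config n, ‖Ψ.ψ (Matrix.vecCons x Y)‖ ^ 2 :=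
    CoarseChainRule.integrable_integral_normSq_vecCons Ψ
  rw [← integral_iUnion_fintype (fun k => measurableSet_subCell s k)
    (TwoScaleReduction.pairwise_disjoint_subCell hs) fun k => hi.integrableOn,
    ← integral_marginal Ψ]
  exact setIntegral_le_integral hi (ae_of_all _ (marginal_nonneg Ψ))

/-- **The within-cell bound, core form**: summed over the `M³` sub-cells of side `s = L/M`,
`Σ_k A_k KL(p_k ‖ u_k) ≤ 3 + s² ∫ |∇₀Ψ|²`. [folklore] -/
theorem core (hL : 0 < L) (hM : 1 ≤ M) (Ψ : TrialState (n + 1) L) (P : Space → ℝ)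
    (hP : P = fun x => ∫ Y : Config n, ‖Ψ.ψ (Matrix.vecCons x Y)‖ ^ 2) :
    ENNReal.ofReal (∑ k : Fin 3 → Fin M, ∫ x in subCell (L / M) k,
        (∫ z in subCell (L / M) k, P z) / (L / M) ^ 3 *
          klFun ((L / M) ^ 3 * P x / ∫ z in subCell (L / M) k, P z)) ≤
      3 + ENNReal.ofReal ((L / M) ^ 2) * ∫⁻ X, partialGradSq 0 Ψ.ψ X := by
  set s : ℝ := L / M with hs_def
  have hMpos : (0 : ℝ) < M := by exact_mod_cast hM
  have hs : 0 < s := div_pos hL hMpos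
  have hP0 : ∀ x, 0 ≤ P x := fun x => by rw [hP]; exact marginal_nonneg Ψ x
  set A : (Fin 3 → Fin M) → ℝ := fun k => ∫ z in subCell s k, P z with hA_def
  set Φ : Space → ℝ≥0∞ := fun x => ∫⁻ Y, partialGradSq 0 Ψ.ψ (Matrix.vecCons x Y) with hΦ_def
  have hA0 : ∀ k, 0 ≤ A k := fun k =>
    setIntegral_nonneg (measurableSet_subCell s k) fun x _ => hP0 x
  have hI0 : ∀ k, 0 ≤ ∫ x in subCell s k, A k / s ^ 3 * klFun (s ^ 3 * P x / A k) :=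
    fun k => setIntegral_nonneg (measurableSet_subCell s k) fun x _ =>
      mul_nonneg (div_nonneg (hA0 k) (pow_nonneg hs.le 3))
        (klFun_nonneg (div_nonneg (mul_nonneg (pow_nonneg hs.le 3) (hP0 x)) (hA0 k)))
  have hsumΦ : ∑ k : Fin 3 → Fin M, ∫⁻ x in subCell s k, Φ x ≤ ∫⁻ X, partialGradSq 0 Ψ.ψ X :=
    calc ∑ k : Fin 3 → Fin M, ∫⁻ x in subCell s k, Φ x ≤ ∫⁻ x, Φ x :=
          sum_setLIntegral_subCell_le hs (measurable_lintegral_partialGradSq_vecCons Ψ).aemeasurable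
      _ = ∫⁻ X, partialGradSq 0 Ψ.ψ X :=
          lintegral_lintegral_vecCons (measurable_partialGradSq 0 Ψ.ψ)
  have hsumA : ∑ k, A k ≤ 1 := by rw [hA_def, hP]; exact sum_setIntegral_marginal_le hs Ψ
  have hsum3 : ∑ k : Fin 3 → Fin M, ENNReal.ofReal (3 * A k) ≤ 3 := by
    rw [← ENNReal.ofReal_sum_of_nonneg fun k _ => by have := hA0 k; positivity, ← Finset.mul_sum]
    calc ENNReal.ofReal (3 * ∑ k, A k) ≤ ENNReal.ofReal (3 * 1) :=
          ENNReal.ofReal_le_ofReal (mul_le_mul_of_nonneg_left hsumA (by norm_num))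
      _ = 3 := by simp
  rw [ENNReal.ofReal_sum_of_nonneg fun k _ => hI0 k]
  calc ∑ k, ENNReal.ofReal (∫ x in subCell s k, A k / s ^ 3 * klFun (s ^ 3 * P x / A k))
      ≤ ∑ k, (ENNReal.ofReal (3 * A k) + ENNReal.ofReal (s ^ 2) * ∫⁻ x in subCell s k, Φ x) :=
        Finset.sum_le_sum fun k _ => cell_bound hs Ψ P hP k
    _ = ∑ k, ENNReal.ofReal (3 * A k) + ENNReal.ofReal (s ^ 2) * ∑ k, ∫⁻ x in subCell s k, Φ x := by
        rw [Finset.sum_add_distrib, Finset.mul_sum]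
    _ ≤ 3 + ENNReal.ofReal (s ^ 2) * ∫⁻ X, partialGradSq 0 Ψ.ψ X := by
        gcongr

end WithinCell

open MeasureTheory Literature.MathematicalPhysics.QuantumManyBody.BoseGas
  Summit.AtomisticToContinuum.BoseEinsteinCondensation.Theorems in
open scoped ENNReal in
/-- **Stub `stub_withinCellFisherLSI`: within-cell entropy via Fisher convexity and the cube
LSI.** For every trial state `Ψ` of `n + 1` bosons in `Λ_L` and every `M ≥ 1`, the mass-weighted
within-cell relative entropies of the one-body marginal `P(x) = ∫ |Ψ(x, Y)|² dY` over the `M³`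
half-open cells of side `s = L/M` satisfy `Σ_k A_k KL(p_k ‖ u_k) ≤ 3 + s² T(Ψ)/(n+1)`:
the defective cube LSI `lsi_cell` applied to `√(P + ε)`, `ε ↓ 0`, with the convexity of the
Fisher information `|∇P|² ≤ 4P ∫|∇ₓΨ|² dY` (Cauchy–Schwarz) and Bose symmetry
`T = (n+1) ∫ |∇₀Ψ|²`. [folklore] -/
theorem stub_withinCellFisherLSI :
    ∀ (n : ℕ) (L : ℝ), 0 < L → ∀ (M : ℕ), 1 ≤ M → ∀ Ψ :
      Literature.MathematicalPhysics.QuantumManyBody.BoseGas.TrialState (n + 1) L, ENNReal.ofReal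
      (∑ k : Fin 3 → Fin M, ∫ x in {y : EuclideanSpace ℝ (Fin 3) | ∀ j, y j ∈ Set.Ico (((k j : ℕ) :
      ℝ) * (L / (M : ℝ))) ((((k j : ℕ) : ℝ) + 1) * (L / (M : ℝ)))}, (∫ z in {y : EuclideanSpace ℝ
      (Fin 3) | ∀ j, y j ∈ Set.Ico (((k j : ℕ) : ℝ) * (L / (M : ℝ))) ((((k j : ℕ) : ℝ) + 1) * (L /
      (M : ℝ)))}, ∫ Y' : Literature.MathematicalPhysics.QuantumManyBody.BoseGas.Config n, ‖Ψ.ψ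
      (Matrix.vecCons z Y')‖ ^ 2) / (L / (M : ℝ)) ^ 3 * InformationTheory.klFun ((L / (M : ℝ)) ^ 3
      * (∫ Y' : Literature.MathematicalPhysics.QuantumManyBody.BoseGas.Config n, ‖Ψ.ψ
      (Matrix.vecCons x Y')‖ ^ 2) / (∫ z in {y : EuclideanSpace ℝ (Fin 3) | ∀ j, y j ∈ Set.Ico (((k
      j : ℕ) : ℝ) * (L / (M : ℝ))) ((((k j : ℕ) : ℝ) + 1) * (L / (M : ℝ)))}, ∫ Y' :
      Literature.MathematicalPhysics.QuantumManyBody.BoseGas.Config n, ‖Ψ.ψ (Matrix.vecCons z Y')‖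
      ^ 2))) ≤ 3 + ENNReal.ofReal ((L / (M : ℝ)) ^ 2) * ((∫⁻ X,
      Literature.MathematicalPhysics.QuantumManyBody.BoseGas.kineticDensity Ψ.ψ X) / ((n + 1 : ℕ) :
      ENNReal)) := by
  intro n L hL M hM Ψ
  simp_rw [TwoScaleReduction.routeCell_eq_subCell]
  have hT : (∫⁻ X, kineticDensity Ψ.ψ X) / ((n + 1 : ℕ) : ℝ≥0∞) = ∫⁻ X, partialGradSq 0 Ψ.ψ X := by
    rw [lintegral_kineticDensity_eq_mul Ψ.contDiff.differentiable_one Ψ.symm, mul_comm,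
      Nat.cast_succ]
    exact ENNReal.mul_div_cancel_right (Nat.cast_add_one_ne_zero n)
      (ENNReal.add_ne_top.2 ⟨ENNReal.natCast_ne_top n, ENNReal.one_ne_top⟩)
  rw [hT]
  exact WithinCell.core hL hM Ψ (fun x => ∫ Y' : Config n, ‖Ψ.ψ (Matrix.vecCons x Y')‖ ^ 2) rfl

end Summit.AtomisticToContinuum.BoseEinsteinCondensation.Cruxes.OneBodyEntropyBound.Birth

end
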